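import Mathlib
import Literature.Analysis.FunctionSpaces.TorusChainRule
import Summits.AnomalousDissipation.AnomalousDissipation.Theorems.NegSteadyThinSetLiouvilleCalculus
import Summits.AnomalousDissipation.AnomalousDissipation.Theorems.NegSteadyThinSetLiouvilleCutoff

/-!
# Thin-set Liouville lemma, part C: the cut-off Bernoulli field and its divergence

Support file for stmt-AnomalousDissipation-1049 (`SteadyNegTameOffThinSets`) via the thin-set
Liouville lemma (stmt-AnomalousDissipation-1047). Setting: `U`, `P` are `C¹` off a closed set
`S ⊆ T^d` (through the lift, on `Ω = proj ⁻¹' Sᶜ`) and solve steady Euler there,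
`(U·∇)U + ∇P = f`, `div U = 0`. With the Bernoulli head `B = ½|U|² + P`, a scalar profile
`h : ℝ → ℝ` and a smooth cut-off `χ` vanishing near `S`, the field `V = χ • h(B) • U` is `C¹` on
the whole torus (`isContDiff_cutoffField`) and, off `S`,
`div V = χ · h'(B) ⟪f, U⟫ + Dχ (h(B) U)` (`divergence_cutoffField`): the transport term
`h(B) χ div U` vanishes and `U·∇B = ⟪U, (U·∇)U + ∇P⟫ = ⟪f, U⟫` (Bernoulli). With bounded `h`
this is the Eulerian device behind the Liouville lemma (part D). Folklore (Bernoulli's theorem;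
e.g. Chorin–Marsden, A Mathematical Introduction to Fluid Mechanics, §1.2).
-/

set_option linter.dupNamespace false  -- `Summit.AnomalousDissipation.AnomalousDissipation` is the mandated summit/problem namespace

noncomputable section

open MeasureTheory Metric Filter Topology Set Function
open scoped InnerProductSpace ContDiff
open Literature.Analysis.FunctionSpaces Literature.Analysis.FunctionSpaces.Torus

namespace Summit.AnomalousDissipation.AnomalousDissipation.Theorems.ThinSetLiouville

variable {d : Type*} [Fintype d] [DecidableEq d]

/-! ## Bernoulli: `U·∇(½|U|² + P) = ⟪f, U⟫` off `S` -/

omit [DecidableEq d] in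
/-- The lifted Bernoulli head `½‖lift U‖² + lift P` has derivative
`v ↦ ⟪lift U y, D(lift U)(y) v⟫ + D(lift P)(y) v` wherever the lifts are differentiable. [folklore] -/
theorem hasFDerivAt_head {U : UnitAddTorus d → EuclideanSpace ℝ d} {P : UnitAddTorus d → ℝ}
    {y : EuclideanSpace ℝ d} (hU : DifferentiableAt ℝ (lift U) y) (hP : DifferentiableAt ℝ (lift P) y) :
    HasFDerivAt (fun z => 2⁻¹ * ‖lift U z‖ ^ 2 + lift P z)
      ((innerSL ℝ (lift U y)).comp (fderiv ℝ (lift U) y) + fderiv ℝ (lift P) y) y := by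
  have h1 := (hU.hasFDerivAt.norm_sq).const_mul (2⁻¹ : ℝ)
  have h2 : HasFDerivAt (fun z => 2⁻¹ * ‖lift U z‖ ^ 2)
      ((innerSL ℝ (lift U y)).comp (fderiv ℝ (lift U) y)) y := by
    refine h1.congr_fderiv ?_
    ext v
    simp only [smul_apply, ContinuousLinearMap.comp_apply, smul_eq_mul,
      nsmul_eq_mul, Nat.cast_ofNat]
    ring
  exact h2.add hP.hasFDerivAt

omit [DecidableEq d] in
/-- **Bernoulli.** Off `S`, the head satisfies `U·∇B = ⟪f, U⟫`:
`D(½‖lift U‖² + lift P)(y) (U (proj y)) = ⟪f (proj y), U (proj y)⟫`. [folklore] -/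
theorem fderiv_head_apply_self {U f : UnitAddTorus d → EuclideanSpace ℝ d} {P : UnitAddTorus d → ℝ}
    {y : EuclideanSpace ℝ d}
    (hEuler : convect U U (proj y) + Torus.gradient P (proj y) = f (proj y)) :
    ((innerSL ℝ (lift U y)).comp (fderiv ℝ (lift U) y) + fderiv ℝ (lift P) y) (U (proj y)) =
      ⟪f (proj y), U (proj y)⟫_ℝ := by
  change ((innerSL ℝ (lift U y)).comp (fderiv ℝ (lift U) y)) (U (proj y)) +
    fderiv ℝ (lift P) y (U (proj y)) = _
  rw [← hEuler, ContinuousLinearMap.comp_apply, innerSL_apply_apply,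
    lift_apply, ← convect_eq_fderiv_lift, ← inner_gradient_eq_fderiv_lift, inner_add_left,
    real_inner_comm (convect U U (proj y))]

/-! ## The cut-off field `V = χ • h(B) • U` -/

section CutoffField

variable {U f : UnitAddTorus d → EuclideanSpace ℝ d} {P : UnitAddTorus d → ℝ} {S : Set (UnitAddTorus d)}
  {χ : UnitAddTorus d → ℝ} {h : ℝ → ℝ}

omit [DecidableEq d] in
/-- `C¹`-ness of the cut-off field: if `U`, `P` are `C¹` on `proj ⁻¹' Sᶜ` through the lift, `h` is
`C¹`, and `χ` is smooth and vanishes on a neighbourhood `N ⊇ S` (`N` open), then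
`x ↦ χ x • h(½‖U x‖² + P x) • U x` is `C¹` on the torus. [folklore] -/
theorem isContDiff_cutoffField (hS : IsClosed S) (hU : ContDiffOn ℝ 1 (lift U) (proj ⁻¹' Sᶜ))
    (hP : ContDiffOn ℝ 1 (lift P) (proj ⁻¹' Sᶜ)) (hh : ContDiff ℝ 1 h) (hχ : IsSmooth χ)
    {N : Set (UnitAddTorus d)} (hN : IsOpen N) (hSN : S ⊆ N) (hχN : ∀ x ∈ N, χ x = 0) :
    IsContDiff 1 (fun x => χ x • (h (2⁻¹ * ‖U x‖ ^ 2 + P x) • U x)) := by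
  have hO : IsOpen (proj ⁻¹' Sᶜ : Set (EuclideanSpace ℝ d)) := hS.isOpen_compl.preimage continuous_proj
  have hB : ContDiffOn ℝ 1 (fun z => 2⁻¹ * ‖lift U z‖ ^ 2 + lift P z) (proj ⁻¹' Sᶜ) :=
    (contDiffOn_const.mul (hU.norm_sq ℝ)).add hP
  have hW : ContDiffOn ℝ 1 (fun z => h (2⁻¹ * ‖lift U z‖ ^ 2 + lift P z) • lift U z) (proj ⁻¹' Sᶜ) :=
    (hh.comp_contDiffOn hB).smul hU
  have hχ1 : ContDiff ℝ 1 (lift χ) := hχ.isContDiff (by simp)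
  show ContDiff ℝ 1 (lift fun x => χ x • (h (2⁻¹ * ‖U x‖ ^ 2 + P x) • U x))
  have hlift : lift (fun x => χ x • (h (2⁻¹ * ‖U x‖ ^ 2 + P x) • U x)) =
      fun z => lift χ z • (h (2⁻¹ * ‖lift U z‖ ^ 2 + lift P z) • lift U z) := rfl
  rw [hlift]
  refine contDiff_iff_contDiffAt.2 fun y => ?_
  by_cases hy : y ∈ (proj ⁻¹' Sᶜ : Set (EuclideanSpace ℝ d))
  · exact hχ1.contDiffAt.smul (hW.contDiffAt (hO.mem_nhds hy))
  · have hyS : proj y ∈ N := hSN (not_notMem.1 hy)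
    have hev : (fun z => lift χ z • (h (2⁻¹ * ‖lift U z‖ ^ 2 + lift P z) • lift U z)) =ᶠ[𝓝 y]
        fun _ => 0 := by
      filter_upwards [(hN.preimage continuous_proj).mem_nhds hyS] with z hz
      rw [lift_apply, hχN _ hz, zero_smul]
    exact (contDiffAt_const (c := (0 : EuclideanSpace ℝ d))).congr_of_eventuallyEq hev

/-- **Divergence of the cut-off field off `S`.** At `x = proj y` with `lift U`, `lift P`
differentiable at `y`, `div U (x) = 0` and `(U·∇)U + ∇P = f` at `x`, for `h` with derivative `h'`
at `B x` and smooth `χ`: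
`div (χ • h(B) • U)(x) = χ x * (h' * ⟪f x, U x⟫) + Dχ(x) (h (B x) • U x)`. [folklore] -/
theorem divergence_cutoffField {y : EuclideanSpace ℝ d} (hU : DifferentiableAt ℝ (lift U) y)
    (hP : DifferentiableAt ℝ (lift P) y) (hχ : IsSmooth χ) {h' : ℝ}
    (hh : HasDerivAt h h' (2⁻¹ * ‖U (proj y)‖ ^ 2 + P (proj y)))
    (hdiv : divergence U (proj y) = 0)
    (hEuler : convect U U (proj y) + Torus.gradient P (proj y) = f (proj y)) :
    divergence (fun x => χ x • (h (2⁻¹ * ‖U x‖ ^ 2 + P x) • U x)) (proj y) =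
      χ (proj y) * (h' * ⟪f (proj y), U (proj y)⟫_ℝ) +
        Torus.fderiv χ (proj y) (h (2⁻¹ * ‖U (proj y)‖ ^ 2 + P (proj y)) • U (proj y)) := by
  -- derivatives of the factors at `y`
  have hBd := hasFDerivAt_head hU hP
  have hhB : HasFDerivAt (fun z => h (2⁻¹ * ‖lift U z‖ ^ 2 + lift P z))
      (h' • ((innerSL ℝ (lift U y)).comp (fderiv ℝ (lift U) y) + fderiv ℝ (lift P) y)) y :=
    hh.comp_hasFDerivAt y hBd
  have hWd : HasFDerivAt (fun z => h (2⁻¹ * ‖lift U z‖ ^ 2 + lift P z) • lift U z)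
      (h (2⁻¹ * ‖lift U y‖ ^ 2 + lift P y) • fderiv ℝ (lift U) y +
        (h' • ((innerSL ℝ (lift U y)).comp (fderiv ℝ (lift U) y) + fderiv ℝ (lift P) y)).smulRight
          (lift U y)) y :=
    hhB.smul hU.hasFDerivAt
  have hχ1 : ContDiff ℝ 1 (lift χ) := hχ.isContDiff (by simp)
  have hχd : HasFDerivAt (lift χ) (fderiv ℝ (lift χ) y) y :=
    (hχ1.differentiable one_ne_zero y).hasFDerivAt
  have hVd : HasFDerivAt (fun z => lift χ z • (h (2⁻¹ * ‖lift U z‖ ^ 2 + lift P z) • lift U z))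
      (lift χ y • (h (2⁻¹ * ‖lift U y‖ ^ 2 + lift P y) • fderiv ℝ (lift U) y +
        (h' • ((innerSL ℝ (lift U y)).comp (fderiv ℝ (lift U) y) + fderiv ℝ (lift P) y)).smulRight
          (lift U y)) +
        (fderiv ℝ (lift χ) y).smulRight (h (2⁻¹ * ‖lift U y‖ ^ 2 + lift P y) • lift U y)) y :=
    hχd.smul hWd
  have hlift : lift (fun x => χ x • (h (2⁻¹ * ‖U x‖ ^ 2 + P x) • U x)) =
      fun z => lift χ z • (h (2⁻¹ * ‖lift U z‖ ^ 2 + lift P z) • lift U z) := rfl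
  -- expand the divergence in coordinates
  rw [divergence_eq_sum_fderiv_lift (by rw [hlift]; exact hVd.differentiableAt), hlift, hVd.fderiv]
  -- abbreviations (values, not definitions)
  have hsum1 : ∑ i, fderiv ℝ (lift U) y (EuclideanSpace.single i 1) i = 0 := by
    rw [← hdiv, divergence_eq_sum_fderiv_lift hU]
  have hsum2 : ∑ i, ((innerSL ℝ (lift U y)).comp (fderiv ℝ (lift U) y) + fderiv ℝ (lift P) y)
      (EuclideanSpace.single i 1) * U (proj y) i = ⟪f (proj y), U (proj y)⟫_ℝ := by
    rw [sum_apply_single_mul, fderiv_head_apply_self hEuler]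
  have hsum3 : ∑ i, fderiv ℝ (lift χ) y (EuclideanSpace.single i 1) * U (proj y) i =
      Torus.fderiv χ (proj y) (U (proj y)) := by
    rw [sum_apply_single_mul, fderiv_lift]
  have hpt : ∀ i, ((lift χ y • (h (2⁻¹ * ‖lift U y‖ ^ 2 + lift P y) • fderiv ℝ (lift U) y +
      (h' • ((innerSL ℝ (lift U y)).comp (fderiv ℝ (lift U) y) + fderiv ℝ (lift P) y)).smulRight
        (lift U y)) + (fderiv ℝ (lift χ) y).smulRight
          (h (2⁻¹ * ‖lift U y‖ ^ 2 + lift P y) • lift U y))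
        (EuclideanSpace.single i 1)) i =
      χ (proj y) * h (2⁻¹ * ‖U (proj y)‖ ^ 2 + P (proj y)) *
          fderiv ℝ (lift U) y (EuclideanSpace.single i 1) i +
        χ (proj y) * h' * (((innerSL ℝ (lift U y)).comp (fderiv ℝ (lift U) y) + fderiv ℝ (lift P) y)
          (EuclideanSpace.single i 1) * U (proj y) i) +
        h (2⁻¹ * ‖U (proj y)‖ ^ 2 + P (proj y)) *
          (fderiv ℝ (lift χ) y (EuclideanSpace.single i 1) * U (proj y) i) := by
    intro i
    simp only [add_apply, smul_apply, ContinuousLinearMap.smulRight_apply, PiLp.add_apply,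
      PiLp.smul_apply, smul_eq_mul, lift_apply]
    ring
  rw [Finset.sum_congr rfl fun i _ => hpt i, Finset.sum_add_distrib, Finset.sum_add_distrib,
    ← Finset.mul_sum, ← Finset.mul_sum, ← Finset.mul_sum, hsum1, hsum2, hsum3, map_smul,
    smul_eq_mul]
  ring

/-! ## The integral identity `∫ χ h'(B) ⟪f,U⟫ = -∫ Dχ (h(B) U)` -/

omit [DecidableEq d] in
/-- The torus derivative of a smooth function is continuous (as a `CLM`-valued map). [folklore] -/
theorem continuous_torusFDeriv {χ : UnitAddTorus d → ℝ} (hχ : IsSmooth χ) :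
    Continuous fun x => Torus.fderiv χ x := by
  rw [← continuous_lift_iff]
  have h : lift (fun x => Torus.fderiv χ x) = fderiv ℝ (lift χ) := by
    funext y; rw [lift_apply, fderiv_lift]
  rw [h]
  exact (hχ.isContDiff (n := 1) (by simp)).continuous_fderiv one_ne_zero

/-- **The integral identity.** Let `S` be a closed null set, `U`, `P` `C¹` off `S` through the
lift, solving steady Euler off `S` with continuous force `f`, `U ∈ L²`; let `h` be `C¹` with
`|h| ≤ M`, derivative `w` continuous with `|w| ≤ 1`; let `χ` be smooth, `|χ| ≤ 1`, with
`‖Dχ‖ ≤ K`, vanishing on an open neighbourhood of `S`. Then, with `B = ½|U|² + P`,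
`∫ χ · w(B) · ⟪f, U⟫ = -∫ Dχ (h(B) • U)` (integrate `div (χ h(B) U) = χ w(B)⟪f,U⟫ + Dχ(h(B)U)`
over the torus). [folklore] -/
theorem integral_cutoff_weight_inner_eq (hS : IsClosed S) (hS0 : volume S = 0)
    (hU : ContDiffOn ℝ 1 (lift U) (proj ⁻¹' Sᶜ)) (hP : ContDiffOn ℝ 1 (lift P) (proj ⁻¹' Sᶜ))
    (hf : Continuous f) (hU2 : MemLp U 2 volume)
    (hEuler : ∀ x ∈ Sᶜ, convect U U x + Torus.gradient P x = f x)
    (hdiv : ∀ x ∈ Sᶜ, divergence U x = 0)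
    {w : ℝ → ℝ} (hh : ∀ s, HasDerivAt h (w s) s) (hw : Continuous w) (hw1 : ∀ s, |w s| ≤ 1)
    {M : ℝ} (hM : ∀ s, |h s| ≤ M)
    (hχ : IsSmooth χ) (hχ1 : ∀ x, |χ x| ≤ 1) {K : ℝ} (hχK : ∀ x, ‖Torus.fderiv χ x‖ ≤ K)
    {N : Set (UnitAddTorus d)} (hN : IsOpen N) (hSN : S ⊆ N) (hχN : ∀ x ∈ N, χ x = 0) :
    ∫ x, χ x * (w (2⁻¹ * ‖U x‖ ^ 2 + P x) * ⟪f x, U x⟫_ℝ) =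
      -∫ x, Torus.fderiv χ x (h (2⁻¹ * ‖U x‖ ^ 2 + P x) • U x) := by
  have hO : IsOpen (proj ⁻¹' Sᶜ : Set (EuclideanSpace ℝ d)) := hS.isOpen_compl.preimage continuous_proj
  have hh1 : ContDiff ℝ 1 h := by
    rw [contDiff_one_iff_deriv]
    refine ⟨fun s => (hh s).differentiableAt, ?_⟩
    have : deriv h = w := funext fun s => (hh s).deriv
    rwa [this]
  -- the cut-off field is `C¹`, so its divergence integrates to zero
  have hV := isContDiff_cutoffField (h := h) hS hU hP hh1 hχ hN hSN hχN
  have hint0 := integral_divergence_eq_zero_of_isContDiff hV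
  -- continuity off `S`
  have hUc : ContinuousOn U Sᶜ := continuousOn_of_contDiffOn_lift hS.isOpen_compl hU
  have hPc : ContinuousOn P Sᶜ := continuousOn_of_contDiffOn_lift hS.isOpen_compl hP
  have hBc : ContinuousOn (fun x => 2⁻¹ * ‖U x‖ ^ 2 + P x) Sᶜ :=
    (continuousOn_const.mul (hUc.norm.pow 2)).add hPc
  have hF1c : ContinuousOn (fun x => χ x * (w (2⁻¹ * ‖U x‖ ^ 2 + P x) * ⟪f x, U x⟫_ℝ)) Sᶜ :=
    hχ.continuous.continuousOn.mul ((hw.comp_continuousOn hBc).mul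
      (hf.continuousOn.inner hUc))
  have hF2c : ContinuousOn (fun x => Torus.fderiv χ x (h (2⁻¹ * ‖U x‖ ^ 2 + P x) • U x)) Sᶜ :=
    (continuous_torusFDeriv hχ).continuousOn.clm_apply
      ((hh1.continuous.comp_continuousOn hBc).smul hUc)
  -- integrability
  obtain ⟨Cf, hCf⟩ : ∃ Cf, ∀ x, ‖f x‖ ≤ Cf := by
    obtain ⟨Cf, hCf⟩ := isCompact_univ.exists_bound_of_continuousOn hf.continuousOn
    exact ⟨Cf, fun x => hCf x (mem_univ x)⟩
  have hUi : Integrable U volume := hU2.integrable one_le_two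
  have hF1i : Integrable (fun x => χ x * (w (2⁻¹ * ‖U x‖ ^ 2 + P x) * ⟪f x, U x⟫_ℝ)) volume := by
    refine Integrable.mono' (hUi.norm.const_mul Cf)
      (aestronglyMeasurable_of_continuousOn_compl_null hS hS0 hF1c) (ae_of_all _ fun x => ?_)
    rw [Real.norm_eq_abs, abs_mul, abs_mul]
    calc |χ x| * (|w (2⁻¹ * ‖U x‖ ^ 2 + P x)| * |⟪f x, U x⟫_ℝ|) ≤ 1 * (1 * (‖f x‖ * ‖U x‖)) := by
          gcongr
          · exact hχ1 x
          · exact hw1 _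
          · exact abs_real_inner_le_norm _ _
      _ ≤ Cf * ‖U x‖ := by
          rw [one_mul, one_mul]
          exact mul_le_mul_of_nonneg_right (hCf x) (norm_nonneg _)
  have hF2i : Integrable (fun x => Torus.fderiv χ x (h (2⁻¹ * ‖U x‖ ^ 2 + P x) • U x)) volume := by
    refine Integrable.mono' (hUi.norm.const_mul (K * M))
      (aestronglyMeasurable_of_continuousOn_compl_null hS hS0 hF2c) (ae_of_all _ fun x => ?_)
    calc ‖Torus.fderiv χ x (h (2⁻¹ * ‖U x‖ ^ 2 + P x) • U x)‖
        ≤ ‖Torus.fderiv χ x‖ * ‖h (2⁻¹ * ‖U x‖ ^ 2 + P x) • U x‖ := ContinuousLinearMap.le_opNorm _ _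
      _ = ‖Torus.fderiv χ x‖ * (|h (2⁻¹ * ‖U x‖ ^ 2 + P x)| * ‖U x‖) := by
          rw [norm_smul, Real.norm_eq_abs]
      _ ≤ K * (M * ‖U x‖) := by
          have hK0 : 0 ≤ K := (norm_nonneg _).trans (hχK x)
          exact mul_le_mul (hχK x) (mul_le_mul_of_nonneg_right (hM _) (norm_nonneg _))
            (mul_nonneg (abs_nonneg _) (norm_nonneg _)) hK0
      _ = K * M * ‖U x‖ := by ring
  -- the divergence formula holds off `S`, i.e. almost everywhere
  have hae : (fun x => divergence (fun x => χ x • (h (2⁻¹ * ‖U x‖ ^ 2 + P x) • U x)) x) =ᵐ[volume]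
      fun x => χ x * (w (2⁻¹ * ‖U x‖ ^ 2 + P x) * ⟪f x, U x⟫_ℝ) +
        Torus.fderiv χ x (h (2⁻¹ * ‖U x‖ ^ 2 + P x) • U x) := by
    filter_upwards [measure_eq_zero_iff_ae_notMem.1 hS0] with x hx
    obtain ⟨y, rfl⟩ := proj_surjective x
    have hy : y ∈ (proj ⁻¹' Sᶜ : Set (EuclideanSpace ℝ d)) := hx
    exact divergence_cutoffField ((hU.differentiableOn one_ne_zero).differentiableAt (hO.mem_nhds hy))
      ((hP.differentiableOn one_ne_zero).differentiableAt (hO.mem_nhds hy)) hχ (hh _) (hdiv _ hx)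
      (hEuler _ hx)
  rw [integral_congr_ae hae, integral_add hF1i hF2i] at hint0
  linarith

end CutoffField

end Summit.AnomalousDissipation.AnomalousDissipation.Theorems.ThinSetLiouville

end
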